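import Mathlib
import HarnessLib
import HarnessLib.Audit
import Summits.HubbardSuperconductivity.Statement
import Literature.MathematicalPhysics.QuantumLattice.DWaveSource
import Literature.MathematicalPhysics.QuantumLattice.XYOrder
import Literature.MathematicalPhysics.QuantumLattice.HubbardScaleReportCT
import Literature.MathematicalPhysics.QuantumLattice.SymmetricRegimeCertificateT

/-!
# SigTest — the X1-repaired item texts as one-line signatures, elaborated in the route file's own import/open context

Crux stmt-HubbardSuperconductivity-13884 (route AposterioriCapRg rev 34), crux-strategist wall-breaker seat, 2026-08-17.  Companion of
`RepairKit.lean` / `REPAIR-KIT.md` / `RepairKitSignatures.md`.  Each `def` body below is EXACTLY the string in `RepairKitSignatures.md` (rev-34 route text with the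
literal substitution of form (a) `…Mu` — Grassmann arguments `μ ↦ μ - U / 2` — or form (b) `…Shift` — operator clauses `μ ↦ μ + U / 2`).
This file imports what the route file imports (minus its Theorems glue modules) and opens what it opens; it does NOT import the route file.
Evidence only.
-/

set_option linter.dupNamespace false

namespace Summit.HubbardSuperconductivity.HubbardSuperconductivity.Theses.AposterioriCapRgSigTest

open scoped BigOperators Topology Manifold Classical MeasureTheory ProbabilityTheory Matrix InnerProductSpace ComplexConjugate ContinuousMap
open Filter Set Function TopologicalSpace MeasureTheory
open Literature.Hubbard

def AposterioriOrderCriterionRMu : Prop :=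
  ∃ kStar etaStar : ℚ, 0 < kStar ∧ 0 < etaStar ∧ ∀ (U μ h₀ : ℝ) (D : Literature.MathematicalPhysics.QuantumLattice.HubbardScaleData), 0 < h₀ → (∀ h ∈ Set.Ioc (0:ℝ) h₀, ∃ L₀ : ℕ, D.IsCertifiedEnclosure (Literature.MathematicalPhysics.QuantumLattice.hubbardScaleReportCT U (μ - U / 2) D h) L₀) → D.MeetsThresholds kStar etaStar → ((D.meanFieldDensity.fst : ℚ) : ℝ) / 2 ≤ Literature.MathematicalPhysics.QuantumLattice.dWaveOrderParameter U μ

def AposterioriOrderCriterionRMuNp : Prop :=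
  ∃ kStar etaStar : ℚ, 0 < kStar ∧ 0 < etaStar ∧ ∀ (U μ h₀ : ℝ) (D : Literature.MathematicalPhysics.QuantumLattice.HubbardScaleData), 0 < h₀ → 0 < D.numPatches → (∀ h ∈ Set.Ioc (0:ℝ) h₀, ∃ L₀ : ℕ, D.IsCertifiedEnclosure (Literature.MathematicalPhysics.QuantumLattice.hubbardScaleReportCT U (μ - U / 2) D h) L₀) → D.MeetsThresholds kStar etaStar → ((D.meanFieldDensity.fst : ℚ) : ℝ) / 2 ≤ Literature.MathematicalPhysics.QuantumLattice.dWaveOrderParameter U μ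

def CapRgSymmetricCertificatePinnedMu : Prop :=
  ∃ U ∈ Set.Icc (2:ℝ) 3, ∃ δ ∈ Set.Icc (1/5:ℝ) (7/20), ∃ μ : ℝ, Filter.Tendsto (fun L : ℕ => ((Literature.MathematicalPhysics.QuantumLattice.hubbardTorusWith 2 (L + 1) 1 U μ).groundStateFunctional Literature.MathematicalPhysics.QuantumLattice.totalNumber).re / ((L + 1 : ℕ) : ℝ) ^ 2) Filter.atTop (nhds (1 - δ)) ∧ ∀ Θ : Literature.MathematicalPhysics.QuantumLattice.SymmetricTolerance, ∃ (K : Literature.MathematicalPhysics.QuantumLattice.TrigPolyC4v) (Λ : ℝ) (L₀ : ℕ), Literature.MathematicalPhysics.QuantumLattice.symmetricRegimeCertificateT U (μ - U / 2) Literature.MathematicalPhysics.QuantumLattice.capRgCornerDataT Θ K Λ L₀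

def SeededBrokenRegimeBoseFermiPinnedMu : Prop :=
  ∀ kStar etaStar : ℚ, 0 < kStar → 0 < etaStar → ∃ Θ : Literature.MathematicalPhysics.QuantumLattice.SymmetricTolerance, ∀ U ∈ Set.Icc (2:ℝ) 3, ∀ δ ∈ Set.Icc (1/5:ℝ) (7/20), ∀ μ : ℝ, Filter.Tendsto (fun L : ℕ => ((Literature.MathematicalPhysics.QuantumLattice.hubbardTorusWith 2 (L + 1) 1 U μ).groundStateFunctional Literature.MathematicalPhysics.QuantumLattice.totalNumber).re / ((L + 1 : ℕ) : ℝ) ^ 2) Filter.atTop (nhds (1 - δ)) → ∀ (K : Literature.MathematicalPhysics.QuantumLattice.TrigPolyC4v) (Λ : ℝ) (L₀ : ℕ), Literature.MathematicalPhysics.QuantumLattice.symmetricRegimeCertificateT U (μ - U / 2) Literature.MathematicalPhysics.QuantumLattice.capRgCornerDataT Θ K Λ L₀ → ∃ h₀ : ℝ, 0 < h₀ ∧ ∃ D : Literature.MathematicalPhysics.QuantumLattice.HubbardScaleData, D.MeetsThresholds kStar etaStar ∧ 0 < D.numPatches ∧ 0 < D.meanFieldDensity.fst ∧ ∀ h ∈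 Set.Ioc (0:ℝ) h₀, ∃ L₀' : ℕ, D.IsCertifiedEnclosure (Literature.MathematicalPhysics.QuantumLattice.hubbardScaleReportCT U (μ - U / 2) D h) L₀'

def AposterioriOrderCriterionRShift : Prop :=
  ∃ kStar etaStar : ℚ, 0 < kStar ∧ 0 < etaStar ∧ ∀ (U μ h₀ : ℝ) (D : Literature.MathematicalPhysics.QuantumLattice.HubbardScaleData), 0 < h₀ → (∀ h ∈ Set.Ioc (0:ℝ) h₀, ∃ L₀ : ℕ, D.IsCertifiedEnclosure (Literature.MathematicalPhysics.QuantumLattice.hubbardScaleReportCT U μ D h) L₀) → D.MeetsThresholds kStar etaStar → ((D.meanFieldDensity.fst : ℚ) : ℝ) / 2 ≤ Literature.MathematicalPhysics.QuantumLattice.dWaveOrderParameter U (μ + U / 2)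

def CapRgSymmetricCertificatePinnedShift : Prop :=
  ∃ U ∈ Set.Icc (2:ℝ) 3, ∃ δ ∈ Set.Icc (1/5:ℝ) (7/20), ∃ μ : ℝ, Filter.Tendsto (fun L : ℕ => ((Literature.MathematicalPhysics.QuantumLattice.hubbardTorusWith 2 (L + 1) 1 U (μ + U / 2)).groundStateFunctional Literature.MathematicalPhysics.QuantumLattice.totalNumber).re / ((L + 1 : ℕ) : ℝ) ^ 2) Filter.atTop (nhds (1 - δ)) ∧ ∀ Θ : Literature.MathematicalPhysics.QuantumLattice.SymmetricTolerance, ∃ (K : Literature.MathematicalPhysics.QuantumLattice.TrigPolyC4v) (Λ : ℝ) (L₀ : ℕ), Literature.MathematicalPhysics.QuantumLattice.symmetricRegimeCertificateT U μ Literature.MathematicalPhysics.QuantumLattice.capRgCornerDataT Θ K Λ L₀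

def SeededBrokenRegimeBoseFermiPinnedShift : Prop :=
  ∀ kStar etaStar : ℚ, 0 < kStar → 0 < etaStar → ∃ Θ : Literature.MathematicalPhysics.QuantumLattice.SymmetricTolerance, ∀ U ∈ Set.Icc (2:ℝ) 3, ∀ δ ∈ Set.Icc (1/5:ℝ) (7/20), ∀ μ : ℝ, Filter.Tendsto (fun L : ℕ => ((Literature.MathematicalPhysics.QuantumLattice.hubbardTorusWith 2 (L + 1) 1 U (μ + U / 2)).groundStateFunctional Literature.MathematicalPhysics.QuantumLattice.totalNumber).re / ((L + 1 : ℕ) : ℝ) ^ 2) Filter.atTop (nhds (1 - δ)) → ∀ (K : Literature.MathematicalPhysics.QuantumLattice.TrigPolyC4v) (Λ : ℝ) (L₀ : ℕ), Literature.MathematicalPhysics.QuantumLattice.symmetricRegimeCertificateT U μ Literature.MathematicalPhysics.QuantumLattice.capRgCornerDataT Θ K Λ L₀ → ∃ h₀ : ℝ, 0 < h₀ ∧ ∃ D : Literature.MathematicalPhysics.QuantumLattice.HubbardScaleData, D.MeetsThresholds kStar etaStar ∧ 0 < D.numPatches ∧ 0 < D.meanFieldDensity.fst ∧ ∀ h ∈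 Set.Ioc (0:ℝ) h₀, ∃ L₀' : ℕ, D.IsCertifiedEnclosure (Literature.MathematicalPhysics.QuantumLattice.hubbardScaleReportCT U μ D h) L₀'

end Summit.HubbardSuperconductivity.HubbardSuperconductivity.Theses.AposterioriCapRgSigTest
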